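import Mathlib
import Summits.SmoothPoincare4.SmoothPoincare4.Theorems.SullivanDualTameOrBrodyR4CoreAFamily
import Summits.SmoothPoincare4.SmoothPoincare4.Theorems.SullivanDualTameOrBrodyR4HelperMemberTails

/-!
# Crux `TameOrBrodyR4` (stmt-SmoothPoincare4-7826), line `Sketch`: the deep stub
# `stub_localFamilyUnique` (CORE-A, lead c6)

The local family through a pencil member with automatic transversality and local uniqueness,
assembled from `helper_familyAt` (the order-`0` implicit function of the vorticity map read
through a chart: centre, members, finite-order joint smoothness, nowhere-tangency at the centre,
smallness, absorption) applied at the given member AND at every member of the resulting family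
(charts at the new centres; the two families agree near the new centre by absorption), and from
`helper_memberTails` (members converging to `u₀` in `C¹_loc` with values converging are eventually
close to `u₀` in the norms of absorption).
-/

-- the registered namespace `Summit.SmoothPoincare4.SmoothPoincare4.…` repeats a component
set_option linter.dupNamespace false

noncomputable section

open scoped ContDiff Topology NNReal
open Filter Set Function Metric Literature.Analysis.Complex Literature.Analysis.FunctionSpaces
  Literature.Geometry.Symplectic

namespace Summit.SmoothPoincare4.SmoothPoincare4.Cruxes.TameOrBrodyR4.Sketch

/-- Local notation for the model space `ℝ⁴ = EuclideanSpace ℝ (Fin 4)`. -/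
local notation "E4" => EuclideanSpace ℝ (Fin 4)


/-- Triangle inequality for the Hölder closeness of derivative differences. -/
theorem LocalFamilyUnique.norm_sub_sub_le {V : Type*} [NormedAddCommGroup V] (a b c a' b' c' : V) :
    ‖(a - c) - (a' - c')‖ ≤ ‖(a - b) - (a' - b')‖ + ‖(b - c) - (b' - c')‖ := by
  have : (a - c) - (a' - c') = ((a - b) - (a' - b')) + ((b - c) - (b' - c')) := by abel
  rw [this]
  exact norm_add_le _ _

/-- **Deep stub `stub_localFamilyUnique` (CORE-A).** Through every member `u₀` of value `b₀`
there is a family `Φ` of members, jointly `C^∞` on `ball b₀ ε × ℂ`, with `Φ b₀ = u₀`, `Φ b` of value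
`b`, nowhere tangent (`∂_b Φ(b, ξ) β ∈ range ∂_ξ Φ(b, ξ)` only for `β = 0`), and locally unique
along sequences of members converging to `u₀` in `C¹_loc` with values converging to `b₀`. -/
theorem stub_localFamilyUnique (J : E4 → E4 →L[ℝ] E4) (R : ℝ) (P Q : E4 →L[ℝ] ℂ)
    (eP eQ : ℂ →L[ℝ] E4) (hR : 0 < R) (hJs : ContDiff ℝ ∞ J) (hJ2 : ∀ x v, J x (J x v) = -v)
    (hPQ : IsCoordFrame P Q eP eQ)
    (hJP : ∀ x : E4, R ≤ ‖x‖ → ∀ v, P (J x v) = Complex.I * P v)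
    (hJQ : ∀ x : E4, R ≤ ‖x‖ → ∀ v, Q (J x v) = Complex.I * Q v) :
    ∀ (b₀ : ℂ) (u₀ : ℂ → E4), IsPencilMember J R P Q b₀ u₀ →
      ∃ ε > 0, ∃ Φ : ℂ → ℂ → E4,
        ContDiffOn ℝ ∞ (fun p : ℂ × ℂ => Φ p.1 p.2) (Metric.ball b₀ ε ×ˢ univ) ∧
        Φ b₀ = u₀ ∧
        (∀ b ∈ Metric.ball b₀ ε, IsPencilMember J R P Q b (Φ b)) ∧
        (∀ b ∈ Metric.ball b₀ ε, ∀ ξ β ζ : ℂ,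
          fderiv ℝ (fun b' => Φ b' ξ) b β = fderiv ℝ (Φ b) ξ ζ → β = 0) ∧
        (∀ (b' : ℕ → ℂ) (w : ℕ → ℂ → E4), (∀ n, IsPencilMember J R P Q (b' n) (w n)) →
          Tendsto b' atTop (𝓝 b₀) → TendstoLocallyUniformly w u₀ atTop →
          TendstoLocallyUniformly (fun n => fderiv ℝ (w n)) (fderiv ℝ u₀) atTop →
          ∀ᶠ n in atTop, w n = Φ (b' n)) := by
  intro b₀ u₀ hu₀
  -- a Hölder exponent in `(0, 1)`
  obtain ⟨r, hr0, hr1⟩ := exists_between (zero_lt_one' ℝ≥0)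
  -- chart and family at the given member
  obtain ⟨𝒞⟩ := helper_existsChartData J R P Q eP eQ hR hJs hJ2 hPQ hJP hJQ b₀ u₀ hu₀
  obtain ⟨ε₀, hε₀, Φ, hΦ0, hmem, -, -, hsmall, θ₀, hθ₀, habs⟩ :=
    helper_familyAt J R P Q eP eQ hR hJs hJ2 hPQ hJP hJQ hr0 hr1 b₀ u₀ hu₀ 𝒞
  have hρ₀ : 0 < 𝒞.ρ₁ + 3 := by linarith [𝒞.hρ₁]
  obtain ⟨ε₁, hε₁, hclose⟩ := hsmall (θ₀ / 2) (by positivity) (𝒞.ρ₁ + 3) hρ₀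
  have hε : 0 < min ε₀ ε₁ := lt_min hε₀ hε₁
  have hsub₀ : ball b₀ (min ε₀ ε₁) ⊆ ball b₀ ε₀ := ball_subset_ball (min_le_left _ _)
  have hsub₁ : ball b₀ (min ε₀ ε₁) ⊆ ball b₀ ε₁ := ball_subset_ball (min_le_right _ _)
  -- KEY: at every member of the family, the family of a chart centred there agrees with `Φ`
  have key : ∀ b ∈ ball b₀ (min ε₀ ε₁), ∃ Φ' : ℂ → ℂ → E4, Φ' b = Φ b ∧
      (∀ m : ℕ, ∃ ε' > (0 : ℝ), ContDiffOn ℝ m (fun p : ℂ × ℂ => Φ' p.1 p.2)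
        (ball b ε' ×ˢ univ)) ∧
      (∀ ξ β ζ : ℂ, fderiv ℝ (fun b' => Φ' b' ξ) b β = fderiv ℝ (Φ b) ξ ζ → β = 0) ∧
      (∀ᶠ b' in 𝓝 b, Φ' b' = Φ b') := by
    intro b hb
    have hmb : IsPencilMember J R P Q b (Φ b) := hmem b (hsub₀ hb)
    obtain ⟨𝒞'⟩ := helper_existsChartData J R P Q eP eQ hR hJs hJ2 hPQ hJP hJQ b (Φ b) hmb
    obtain ⟨ε', hε', Φ', hΦ'0, hmem', hCm', hNT', hsmall', -, -, -⟩ :=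
      helper_familyAt J R P Q eP eQ hR hJs hJ2 hPQ hJP hJQ hr0 hr1 b (Φ b) hmb 𝒞'
    obtain ⟨ε₂, hε₂, hclose'⟩ := hsmall' (θ₀ / 2) (by positivity) (𝒞.ρ₁ + 3) hρ₀
    refine ⟨Φ', hΦ'0, hCm', hNT', ?_⟩
    have hnb : ∀ᶠ b' in 𝓝 b, b' ∈ ball b (min ε' ε₂) ∧ b' ∈ ball b₀ (min ε₀ ε₁) :=
      Filter.Eventually.and (isOpen_ball.mem_nhds (mem_ball_self (lt_min hε' hε₂)))
        (isOpen_ball.mem_nhds hb)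
    filter_upwards [hnb] with b' ⟨hb'1, hb'2⟩
    obtain ⟨c0, c1, c2⟩ := hclose b (hsub₁ hb)
    obtain ⟨d0, d1, d2⟩ := hclose' b' (ball_subset_ball (min_le_right _ _) hb'1)
    refine habs b' (hsub₀ hb'2) (Φ' b') (hmem' b' (ball_subset_ball (min_le_left _ _) hb'1))
      (fun ξ => ?_) (fun ξ hξ => ?_) (fun ξ hξ ξ' hξ' => ?_)
    · calc ‖Φ' b' ξ - u₀ ξ‖ ≤ ‖Φ' b' ξ - Φ b ξ‖ + ‖Φ b ξ - u₀ ξ‖ := norm_sub_le_norm_sub_add_norm_sub _ _ _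
        _ ≤ θ₀ / 2 + θ₀ / 2 := add_le_add (d0 ξ) (c0 ξ)
        _ = θ₀ := by ring
    · calc ‖fderiv ℝ (Φ' b') ξ - fderiv ℝ u₀ ξ‖
          ≤ ‖fderiv ℝ (Φ' b') ξ - fderiv ℝ (Φ b) ξ‖ + ‖fderiv ℝ (Φ b) ξ - fderiv ℝ u₀ ξ‖ :=
            norm_sub_le_norm_sub_add_norm_sub _ _ _
        _ ≤ θ₀ / 2 + θ₀ / 2 := add_le_add (d1 ξ hξ) (c1 ξ hξ)
        _ = θ₀ := by ring
    · calc ‖(fderiv ℝ (Φ' b') ξ - fderiv ℝ u₀ ξ) - (fderiv ℝ (Φ' b') ξ' - fderiv ℝ u₀ ξ')‖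
          ≤ ‖(fderiv ℝ (Φ' b') ξ - fderiv ℝ (Φ b) ξ) - (fderiv ℝ (Φ' b') ξ' - fderiv ℝ (Φ b) ξ')‖ +
            ‖(fderiv ℝ (Φ b) ξ - fderiv ℝ u₀ ξ) - (fderiv ℝ (Φ b) ξ' - fderiv ℝ u₀ ξ')‖ :=
            LocalFamilyUnique.norm_sub_sub_le _ _ _ _ _ _
        _ ≤ θ₀ / 2 * ‖ξ - ξ'‖ ^ (r : ℝ) + θ₀ / 2 * ‖ξ - ξ'‖ ^ (r : ℝ) :=
            add_le_add (d2 ξ hξ ξ' hξ') (c2 ξ hξ ξ' hξ')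
        _ = θ₀ * ‖ξ - ξ'‖ ^ (r : ℝ) := by ring
  refine ⟨min ε₀ ε₁, hε, Φ, ?_, hΦ0, fun b hb => hmem b (hsub₀ hb), ?_, ?_⟩
  · -- joint smoothness: locally `Φ = Φ'`, which is `C^m` near the new centre for every `m`
    rw [contDiffOn_infty]
    intro m
    refine contDiffOn_of_locally_contDiffOn fun p hp => ?_
    obtain ⟨hb, -⟩ := mem_prod.mp hp
    obtain ⟨Φ', -, hCm', -, hagree⟩ := key p.1 hb
    obtain ⟨ε', hε', hC⟩ := hCm' m
    obtain ⟨τ, hτ, hballτ⟩ := Metric.eventually_nhds_iff_ball.mp hagree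
    refine ⟨ball p.1 (min ε' τ) ×ˢ univ, isOpen_ball.prod isOpen_univ,
      mem_prod.mpr ⟨mem_ball_self (lt_min hε' hτ), mem_univ _⟩, ?_⟩
    have hsub : (ball b₀ (min ε₀ ε₁) ×ˢ univ) ∩ (ball p.1 (min ε' τ) ×ˢ univ) ⊆
        ball p.1 ε' ×ˢ (univ : Set ℂ) := by
      rintro q ⟨-, hq⟩
      exact mem_prod.mpr ⟨ball_subset_ball (min_le_left _ _) (mem_prod.mp hq).1, mem_univ _⟩
    refine (hC.mono hsub).congr fun q hq => ?_
    have hq1 : q.1 ∈ ball p.1 τ := ball_subset_ball (min_le_right _ _) (mem_prod.mp hq.2).1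
    change Φ q.1 q.2 = Φ' q.1 q.2
    rw [hballτ q.1 hq1]
  · -- nowhere tangent: locally `Φ = Φ'`, and `Φ'` is nowhere tangent at its centre `b`
    intro b hb ξ β ζ h
    obtain ⟨Φ', -, -, hNT', hagree⟩ := key b hb
    refine hNT' ξ β ζ ?_
    have hev : (fun b' => Φ' b' ξ) =ᶠ[𝓝 b] fun b' => Φ b' ξ :=
      hagree.mono fun b' hb' => by simp only [hb']
    rw [hev.fderiv_eq]
    exact h
  · -- local uniqueness along sequences
    intro b' w hw hb h0 h1
    have htail := helper_memberTails J R P Q eP eQ hR hJs hJ2 hPQ hJP hJQ hr0 hr1 b₀ u₀ hu₀ b' w hw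
      hb h0 h1 (𝒞.ρ₁ + 3) θ₀ hρ₀ hθ₀
    have hbn : ∀ᶠ n in atTop, b' n ∈ ball b₀ (min ε₀ ε₁) :=
      hb (isOpen_ball.mem_nhds (mem_ball_self hε))
    filter_upwards [htail, hbn] with n hn hbn'
    exact habs (b' n) (hsub₀ hbn') (w n) (hw n) hn.1 hn.2.1 hn.2.2

end Summit.SmoothPoincare4.SmoothPoincare4.Cruxes.TameOrBrodyR4.Sketch
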